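import Mathlib
import HarnessLib
import Literature.Analysis.FluidPDE.SelfSimilar
import Literature.Analysis.UnboundedOperators.HeatKernel
import Literature.Analysis.UnboundedOperators.HeatExtensionDecay
import Summits.NavierStokesRegularity.NavierStokesRegularity.Theorems.PoloidalWindowDoorPoloidalWindowRigidityFluxTransport

/-!
# Route `PoloidalWindowDoor`, crux `PoloidalWindowRigidity` (stmt-NavierStokesRegularity-19708) — LINE 16 «zero_mode» (ns-idea-8 g8, v1.1), stub Z-heat
# `stub_zeroModeHeat`: THE FREE (CALORIC) EVOLUTION HAS BOX INTEGRALS BOUNDED BY THE TYPE-I DATUM TIMES THE VOLUME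

Cell ns-regularity-ideate, seat ns-poloidal-K2-p2 g12 (K2 hand).  Statement = the body of `ZeroModeHeat` (`Cruxes/PoloidalWindowRigidity/Lines/zero_mode.lean`
v1.1) VERBATIM, with the Cruxes-local `flatBox R H` unfolded to `{x | |x 0| ≤ R ∧ |x 1| ≤ R ∧ 0 ≤ x 2 ∧ x 2 ≤ H}` (as in stub F):
`|∫_{Q_{R,H}} (e^{(t−s)Δ}v(s))₂| ≤ (C/√(−s))·4R²H`.

PROOF.  Pointwise `‖e^{(t−s)Δ}v(s)(x)‖ ≤ C/√(−s)` (`Literature.Analysis.UnboundedOperators.norm_heatExtension_le_of_bound`, the heat kernel has mass one,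
from the Type-I bound `‖v(s,y)‖ ≤ C/√(−s)` of `HasTypeITimeDecay`), the component bound `|w 2| ≤ ‖w‖` (`PiLp.norm_apply_le`), and
`MeasureTheory.norm_setIntegral_le_of_norm_le_const` with `|Q_{R,H}| = 4R²H` (`…FluxTransport.volume_flatBox`).

WHAT THIS IS NOT: the S half of stub Z only; Z-oseen (L), C2a, C2b, S0, the wall ⟨27893⟩ untouched; 19708 / 20428 OPEN; no claim about Navier–Stokes regularity.
-/

noncomputable section

-- the summit and its single sub-problem share the name (CONVENTIONS §1), as in every Theorems file
set_option linter.dupNamespace false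

namespace Summit.NavierStokesRegularity.NavierStokesRegularity.Theorems.PoloidalWindowDoorPoloidalWindowRigidityZeroModeHeat

open MeasureTheory Set Function Filter Topology
open scoped RealInnerProductSpace ENNReal
open Literature.Analysis Literature.Analysis.FluidPDE Literature.Analysis.UnboundedOperators
open Summit.NavierStokesRegularity.NavierStokesRegularity.Theorems.PoloidalWindowDoorPoloidalWindowRigidityFluxTransport

/-- **Stub Z-heat `stub_zeroModeHeat` of LINE 16 «zero_mode» (VERBATIM body of `ZeroModeHeat`, `flatBox` unfolded).**  See the module docstring. -/
theorem stub_zeroModeHeat :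
    ∀ (C : ℝ) (v : ℝ → EuclideanSpace ℝ (Fin 3) → EuclideanSpace ℝ (Fin 3)),
    Literature.Analysis.FluidPDE.HasTypeITimeDecay C v →
    ∀ s t : ℝ, s < t → t < 0 → ∀ R H : ℝ, 0 < R → 0 < H →
      |∫ x in {x : EuclideanSpace ℝ (Fin 3) | |x 0| ≤ R ∧ |x 1| ≤ R ∧ 0 ≤ x 2 ∧ x 2 ≤ H},
          Literature.Analysis.UnboundedOperators.heatExtension (v s) (t - s) x 2| ≤
        C / Real.sqrt (-s) * (4 * R ^ 2 * H) := by
  intro C v hT s t hst ht R H hR hH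
  have hs0 : s < 0 := hst.trans ht
  have hpt : ∀ x : EuclideanSpace ℝ (Fin 3), ‖heatExtension (v s) (t - s) x 2‖ ≤ C / Real.sqrt (-s) := fun x =>
    (PiLp.norm_apply_le _ 2).trans (norm_heatExtension_le_of_bound (fun z => hT s hs0 z) (sub_pos.2 hst) x)
  have hvol : volume.real {x : EuclideanSpace ℝ (Fin 3) | |x 0| ≤ R ∧ |x 1| ≤ R ∧ 0 ≤ x 2 ∧ x 2 ≤ H} = 4 * R ^ 2 * H := by
    rw [measureReal_def, volume_flatBox H hR.le, ENNReal.toReal_ofReal (by positivity)]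
  have h := norm_setIntegral_le_of_norm_le_const (by rw [volume_flatBox H hR.le]; exact ENNReal.ofReal_lt_top) fun x _ => hpt x
  rw [hvol, Real.norm_eq_abs] at h
  exact h

end Summit.NavierStokesRegularity.NavierStokesRegularity.Theorems.PoloidalWindowDoorPoloidalWindowRigidityZeroModeHeat

end
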